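import Literature.AlgebraicGeometry.Resolution.RegularLocalRingsQuotient
import Literature.AlgebraicGeometry.Resolution.RegularLocusPerfectFibre
import Literature.AlgebraicGeometry.Resolution.SmoothFibreCriterionPointwise
import Mathlib.FieldTheory.IsAlgClosed.AlgebraicClosure
import HarnessLib

/-!
# [OURS · L1 W8.2] Local algebra for the DIAGONAL (self-product) criterion of smoothness: the section lemma for
# regular local rings; the residue field at a rational point; smoothness at a point under ANY extension of the base field

Cell `res-hironaka` (run/shared/lean/pub/res-hironaka/), LADDER-RESOLUTION rung L (RESCUE), slot W8.2; host route
`UniversalCells`, host item `PrimeFieldToPerfect` (stmt-ResolutionOfSingularities-15233), door 1. Proofs file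
(Theses-free), written by res-L1-s82-pv-1 (gen 6). Lemmas for form (E5) of Cruxes/PrimeFieldToPerfect/KERNEL.md §2
(«diagonal form: `Y` regular of finite type over `K` is smooth over `K` iff `Y ×_K Y` is regular at the points of the
diagonal»), proved in `…CampaignW82DiagonalCriterion.lean` for EVERY base field `K`:

* §1 **the section lemma** `isRegularLocalRing_quotient_map_maximalIdeal_of_comp_eq_id`: `i : A → B` a local
  homomorphism of local rings (`A` Noetherian, `B` REGULAR local) with a retraction `r : B → A` (`r ∘ i = id`) ⇒ the
  fibre ring `B ⧸ 𝔪_A B` is a regular local ring. Induction on the embedding dimension of `A` with Matsumura 14.2 (tree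
  `IsRegularLocalRing.quotient_span_singleton`): for `g ∈ 𝔪_A ∖ 𝔪_A²`, `i g ∈ 𝔪_B ∖ 𝔪_B²` (apply the retraction,
  itself a local homomorphism), `B/(i g)` is regular with the induced section over `A/(g)`, and
  `(B/(i g)) ⧸ 𝔪_{A/(g)} = B ⧸ 𝔪_A B`. Use: `A = 𝒪_{Y,y} → B = 𝒪_{Y ×_K Y, Δ(y)}` with the retraction `Δ^*`.
* §2 `formallySmooth_residueField_localization_ker`: at a `k`-RATIONAL point `ev : F →ₐ[k] k` the residue field of
  `F_{ker ev}` is `k` (hypothesis of Stacks 00TV in the tree's `isSmoothAt_of_isRegularLocalRing_of_formallySmooth_residueField`).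
* §3 `isSmoothAt_of_algEquiv` (transport) and **`isSmoothAt_of_isSmoothAt_baseChange_field`**: for ANY field extension
  `L ⊇ K`, `A` of finite type over `K` and a prime `Q ⊂ L ⊗_K A` at which `L ⊗_K A` is `L`-smooth, `A` is `K`-smooth
  at `Q ∩ A` (through an algebraic closure of `L`, smooth ⇒ regular, and the tree's Stacks 038X
  `isSmoothAt_of_isRegularLocalRing_tensor_perfectField`).

HONEST FRAMING. OURS support lemmas (classical commutative algebra: Matsumura 14.2, Stacks 00TV/038X/02VL, assembled
from the tree); they replace the role of no printed item of [Hironaka2017] and are NOT statements of the manuscript;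
nothing is attributed to its author. Not progress on the open residual of slot W8.2 by themselves. AI work, weaker
than expert review; no claim beyond the kernel. No `sorry`, no new axioms.

## References (locators only)
* H. Matsumura, *Commutative Ring Theory* (1986), Thm. 14.2. [Matsumura1987]
* The Stacks Project, Tags 00TV, 038X, 02VL. [StacksProject]
-/

noncomputable section

set_option linter.dupNamespace false -- mandated namespace of this single-conjunct summit

open IsLocalRing TensorProduct
open Literature.AlgebraicGeometry.Resolution

namespace Summit.ResolutionOfSingularities.ResolutionOfSingularities.Theorems.CampaignW82

universe u v



/-! ## §1 A regular local ring with a section: the fibre of the section's base is regular -/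

section SectionLemma

variable {A : Type u} {B : Type v} [CommRing A] [CommRing B] [IsLocalRing A] [IsLocalRing B]

/-- A retraction `r : B → A` of a ring map `i : A → B` between local rings (`r ∘ i = id`) is a local
homomorphism: if `r b` is a unit then `b = i (r b) + (b - i (r b))` is a unit plus an element of the
kernel of `r`, which lies in the maximal ideal. [folklore] -/
theorem isLocalHom_of_comp_eq_id (i : A →+* B) (r : B →+* A) (hri : r.comp i = RingHom.id A) :
    IsLocalHom r := by
  refine ⟨fun b hb => ?_⟩
  have hc : b - i (r b) ∈ maximalIdeal B := by
    by_contra hc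
    have hu : IsUnit (b - i (r b)) := not_not.mp fun h => hc ((mem_maximalIdeal _).mpr h)
    have h0 : r (b - i (r b)) = 0 := by
      rw [map_sub, ← RingHom.comp_apply, hri, RingHom.id_apply, sub_self]
    exact not_isUnit_zero (h0 ▸ hu.map r)
  by_contra hbu
  have hbm : b ∈ maximalIdeal B := (mem_maximalIdeal _).mpr hbu
  have him : i (r b) ∈ maximalIdeal B := by
    have := Ideal.sub_mem _ hbm hc
    rwa [sub_sub_cancel] at this
  exact (mem_maximalIdeal _).mp him (hb.map i)

/-- The kernel side of a retraction: `r` maps the maximal ideal of `B` into that of `A` and hence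
`𝔪_B ^ n` into `𝔪_A ^ n`. [folklore] -/
theorem map_pow_maximalIdeal_le_of_comp_eq_id (i : A →+* B) (r : B →+* A)
    (hri : r.comp i = RingHom.id A) (n : ℕ) :
    ((maximalIdeal B) ^ n).map r ≤ (maximalIdeal A) ^ n := by
  haveI := isLocalHom_of_comp_eq_id i r hri
  rw [Ideal.map_pow]
  exact Ideal.pow_right_mono (map_maximalIdeal_le r) n

/-- **The section lemma.** Let `i : A → B` be a local homomorphism of local rings with `A`
Noetherian and `B` a regular local ring, admitting a retraction `r : B → A` (`r ∘ i = id`). Then the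
"fibre ring" `B ⧸ 𝔪_A B` is a regular local ring. Proof by induction on the embedding dimension of
`A`: for `g ∈ 𝔪_A ∖ 𝔪_A²` the element `i g` lies in `𝔪_B ∖ 𝔪_B²` (apply `r`), so `B/(i g)` is
regular (Matsumura 14.2) and carries the induced section over `A/(g)`, whose embedding dimension
is one less; and `(B/(i g)) ⧸ 𝔪_{A/(g)} = B ⧸ 𝔪_A B`. [cite: Matsumura1987, Thm. 14.2] -/
theorem isRegularLocalRing_quotient_map_maximalIdeal_of_comp_eq_id_aux :
    ∀ (d : ℕ) {A : Type u} {B : Type v} [CommRing A] [CommRing B] [IsLocalRing A]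
      [IsNoetherianRing A] [IsRegularLocalRing B] (i : A →+* B) (r : B →+* A) [IsLocalHom i],
      r.comp i = RingHom.id A → (maximalIdeal A).spanFinrank = d →
      IsRegularLocalRing (B ⧸ (maximalIdeal A).map i) := by
  intro d
  induction d with
  | zero =>
    intro A B _ _ _ _ _ i r _ hri hd
    have hbot : maximalIdeal A = ⊥ :=
      (Submodule.spanFinrank_eq_zero_iff_eq_bot (maximalIdeal A).fg_of_isNoetherianRing).mp hd
    have hmap : (maximalIdeal A).map i = ⊥ := by rw [hbot, Ideal.map_bot]
    exact IsRegularLocalRing.of_ringEquiv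
      ((RingEquiv.quotientBot B).symm.trans (Ideal.quotEquivOfEq hmap.symm))
  | succ d ih =>
    intro A B _ _ _ _ _ i r _ hri hd
    -- an element `g ∈ 𝔪_A ∖ 𝔪_A²`
    have hne : maximalIdeal A ≠ ⊥ := by
      intro h
      rw [h, Submodule.spanFinrank_bot] at hd
      exact Nat.succ_ne_zero d hd.symm
    obtain ⟨g, hg, hg2⟩ := exists_mem_maximalIdeal_not_mem_sq hne
    haveI hrloc : IsLocalHom r := isLocalHom_of_comp_eq_id i r hri
    have hrig : r (i g) = g := by
      rw [← RingHom.comp_apply, hri, RingHom.id_apply]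
    -- `x = i g ∈ 𝔪_B ∖ 𝔪_B²`
    set x : B := i g with hxdef
    have hx : x ∈ maximalIdeal B := map_nonunit i g hg
    have hx2 : x ∉ (maximalIdeal B) ^ 2 := by
      intro hx2
      apply hg2
      have h1 : r x ∈ ((maximalIdeal B) ^ 2).map r := Ideal.mem_map_of_mem r hx2
      rw [hxdef, hrig] at h1
      exact map_pow_maximalIdeal_le_of_comp_eq_id i r hri 2 h1
    -- the quotients `A₁ = A/(g)`, `B₁ = B/(x)`
    haveI hB₁ : IsRegularLocalRing (B ⧸ Ideal.span {x}) :=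
      (IsRegularLocalRing.quotient_span_singleton hx hx2).1
    haveI : Nontrivial (A ⧸ Ideal.span {g}) :=
      Ideal.Quotient.nontrivial_iff.mpr (Ideal.span_singleton_ne_top hg)
    haveI hA₁ : IsLocalRing (A ⧸ Ideal.span {g}) := isLocalRing_quotient (Ideal.span_singleton_ne_top hg)
    have hle₁ : Ideal.span {g} ≤ (Ideal.span {x}).comap i := by
      rw [Ideal.span_le, Set.singleton_subset_iff]
      exact Ideal.subset_span rfl
    have hle₂ : Ideal.span {x} ≤ (Ideal.span {g}).comap r := by
      rw [Ideal.span_le, Set.singleton_subset_iff, SetLike.mem_coe, Ideal.mem_comap, hxdef, hrig]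
      exact Ideal.subset_span rfl
    let i₁ : A ⧸ Ideal.span {g} →+* B ⧸ Ideal.span {x} := Ideal.quotientMap (Ideal.span {x}) i hle₁
    let r₁ : B ⧸ Ideal.span {x} →+* A ⧸ Ideal.span {g} := Ideal.quotientMap (Ideal.span {g}) r hle₂
    have hri₁ : r₁.comp i₁ = RingHom.id _ := by
      refine Ideal.Quotient.ringHom_ext ?_
      rw [RingHom.comp_assoc, Ideal.quotientMap_comp_mk, ← RingHom.comp_assoc, Ideal.quotientMap_comp_mk,
        RingHom.comp_assoc, hri]
      rfl
    -- `i₁` is a local homomorphism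
    haveI hmkB : IsLocalHom (Ideal.Quotient.mk (Ideal.span {x})) :=
      IsLocalHom.of_surjective _ Ideal.Quotient.mk_surjective
    haveI : IsLocalHom i₁ := by
      refine ⟨fun a ha => ?_⟩
      obtain ⟨a, rfl⟩ := Ideal.Quotient.mk_surjective a
      have h1 : i₁ (Ideal.Quotient.mk _ a) = Ideal.Quotient.mk _ (i a) := rfl
      rw [h1] at ha
      exact (isUnit_of_map_unit i a (isUnit_of_map_unit _ _ ha)).map _
    -- embedding dimension drops by one
    have hd₁ : (maximalIdeal (A ⧸ Ideal.span {g})).spanFinrank = d := by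
      have := spanFinrank_maximalIdeal_quotient_add_one hg hg2
      omega
    -- induction hypothesis
    have hreg := ih i₁ r₁ hri₁ hd₁
    -- `(B/(x)) ⧸ 𝔪_{A/(g)} (B/(x)) ≃ B ⧸ 𝔪_A B`
    have hmax : maximalIdeal (A ⧸ Ideal.span {g}) = (maximalIdeal A).map (Ideal.Quotient.mk _) :=
      maximalIdeal_quotient_eq_map _
    have hmapeq : (maximalIdeal (A ⧸ Ideal.span {g})).map i₁ =
        ((maximalIdeal A).map i).map (Ideal.Quotient.mk (Ideal.span {x})) := by
      rw [hmax, Ideal.map_map, Ideal.map_map, Ideal.quotientMap_comp_mk]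
    have hsup : Ideal.span {x} ⊔ (maximalIdeal A).map i = (maximalIdeal A).map i := by
      refine sup_eq_right.mpr ?_
      rw [Ideal.span_le, Set.singleton_subset_iff]
      exact Ideal.mem_map_of_mem i hg
    let e : (B ⧸ Ideal.span {x}) ⧸ (maximalIdeal (A ⧸ Ideal.span {g})).map i₁ ≃+* B ⧸ (maximalIdeal A).map i :=
      (Ideal.quotEquivOfEq hmapeq).trans
        ((DoubleQuot.quotQuotEquivQuotSup (Ideal.span {x}) ((maximalIdeal A).map i)).trans
          (Ideal.quotEquivOfEq hsup))
    exact @IsRegularLocalRing.of_ringEquiv _ _ hreg _ _ e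

omit [IsLocalRing B] in
/-- **The section lemma** (Matsumura 14.2 applied to a regular system of parameters coming from
the base): `i : A → B` a local homomorphism of local rings, `A` Noetherian, `B` regular local,
`r : B → A` a retraction of `i`; then `B ⧸ 𝔪_A B` is a regular local ring.
[cite: Matsumura1987, Thm. 14.2] -/
theorem isRegularLocalRing_quotient_map_maximalIdeal_of_comp_eq_id [IsNoetherianRing A]
    [IsRegularLocalRing B] (i : A →+* B) (r : B →+* A) [IsLocalHom i]
    (hri : r.comp i = RingHom.id A) : IsRegularLocalRing (B ⧸ (maximalIdeal A).map i) :=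
  isRegularLocalRing_quotient_map_maximalIdeal_of_comp_eq_id_aux _ i r hri rfl

end SectionLemma





/-! ## §2 A rational point: the residue field at the kernel of `ev : F → k` is `k` -/

section RationalPoint

variable {k : Type u} {F : Type v} [Field k] [CommRing F] [Algebra k F]

/-- At a `k`-rational point `ev : F →ₐ[k] k` of a `k`-algebra `F`, the residue field of the local ring
`F_{ker ev}` is `k` itself: the structure map `k → κ(ker ev)` is surjective (every `f ∈ F` is congruent
to the constant `ev f` modulo `ker ev`). [folklore] -/
theorem surjective_algebraMap_residueField_localization_ker (ev : F →ₐ[k] k)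
    [(RingHom.ker ev.toRingHom).IsPrime] :
    Function.Surjective
      (algebraMap k (ResidueField (Localization.AtPrime (RingHom.ker ev.toRingHom)))) := by
  set q : Ideal F := RingHom.ker ev.toRingHom with hq
  let Fq := Localization.AtPrime q
  let κ' := ResidueField Fq
  -- `residue (algebraMap F Fq f) = algebraMap k κ' (ev f)`
  have hres : ∀ f : F, IsLocalRing.residue Fq (algebraMap F Fq f) = algebraMap k κ' (ev f) := by
    intro f
    have hmem : f - algebraMap k F (ev f) ∈ q := by
      rw [hq, RingHom.mem_ker]
      change ev (f - algebraMap k F (ev f)) = 0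
      rw [map_sub, AlgHom.commutes, Algebra.algebraMap_self, RingHom.id_apply, sub_self]
    have h1 : algebraMap F Fq (f - algebraMap k F (ev f)) ∈ maximalIdeal Fq :=
      (IsLocalization.AtPrime.to_map_mem_maximal_iff Fq q _).mpr hmem
    rw [map_sub, ← IsScalarTower.algebraMap_apply] at h1
    have h2 : IsLocalRing.residue Fq (algebraMap F Fq f) -
        IsLocalRing.residue Fq (algebraMap k Fq (ev f)) = 0 := by
      rw [← map_sub, IsLocalRing.residue_eq_zero_iff]
      exact h1
    rw [sub_eq_zero] at h2
    rw [h2]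
    exact (IsScalarTower.algebraMap_apply k Fq κ' (ev f)).symm
  intro z
  obtain ⟨y, rfl⟩ := IsLocalRing.residue_surjective z
  obtain ⟨⟨f, s⟩, rfl⟩ := IsLocalization.mk'_surjective q.primeCompl y
  have hs : ev s.1 ≠ 0 := fun h => s.2 (RingHom.mem_ker.mpr h)
  refine ⟨ev f * (ev s.1)⁻¹, ?_⟩
  have hspec : IsLocalization.mk' Fq f s * algebraMap F Fq s.1 = algebraMap F Fq f :=
    IsLocalization.mk'_spec Fq f s
  have h3 : IsLocalRing.residue Fq (IsLocalization.mk' Fq f s) * algebraMap k κ' (ev s.1) =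
      algebraMap k κ' (ev f) := by
    rw [← hres, ← hres, ← map_mul, hspec]
  change algebraMap k κ' _ = IsLocalRing.residue Fq (IsLocalization.mk' Fq f s)
  rw [map_mul, map_inv₀, ← h3, mul_assoc, mul_inv_cancel₀ ((map_ne_zero _).mpr hs), mul_one]

/-- … hence the residue field at a rational point is FORMALLY SMOOTH over `k` (it is `k`).
[folklore] -/
theorem formallySmooth_residueField_localization_ker (ev : F →ₐ[k] k)
    [(RingHom.ker ev.toRingHom).IsPrime] :
    Algebra.FormallySmooth k (ResidueField (Localization.AtPrime (RingHom.ker ev.toRingHom))) := by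
  let κ' := ResidueField (Localization.AtPrime (RingHom.ker ev.toRingHom))
  let e : k ≃ₐ[k] κ' := AlgEquiv.ofBijective (Algebra.ofId k κ')
    ⟨(algebraMap k κ').injective, surjective_algebraMap_residueField_localization_ker ev⟩
  exact Algebra.FormallySmooth.of_equiv e

end RationalPoint

/-! ## §3 Smoothness at a point: transport along an isomorphism, descent along any extension of the base field -/

section Transport

/-- Smoothness at a prime is transported along an `R`-algebra isomorphism. [folklore] -/
theorem isSmoothAt_of_algEquiv {R S S' : Type*} [CommRing R] [CommRing S] [CommRing S'] [Algebra R S]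
    [Algebra R S'] (e : S ≃ₐ[R] S') (q : Ideal S) [q.IsPrime] (Q : Ideal S') [Q.IsPrime]
    (hQ : q = Q.comap e) [h : Algebra.IsSmoothAt R q] : Algebra.IsSmoothAt R Q := by
  haveI : Algebra.FormallySmooth R (Localization.AtPrime q) := h
  exact Algebra.FormallySmooth.of_equiv (Localization.localAlgEquiv q Q e hQ)

end Transport

section FieldDescent

variable (K : Type u) [Field K] (A : Type u) [CommRing A] [Algebra K A] [Algebra.FiniteType K A]
  (L : Type u) [Field L] [Algebra K L]

/-- **Smoothness at a point descends along ANY extension of the base field**: `A` of finite type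
over the field `K`, `L ⊇ K` an arbitrary field extension, `Q ⊂ L ⊗_K A` a prime at which `L ⊗_K A`
is `L`-smooth; then `A` is `K`-smooth at `Q ∩ A`. Proof: base-change further to an algebraic
closure `k` of `L` (a prime `Q₁` over `Q` exists, `k/L` being algebraic), where smooth implies
regular; `k` is perfect, and a regular point of `k ⊗_K A` lies over a smooth point of `A`
(`isSmoothAt_of_isRegularLocalRing_tensor_perfectField`, Stacks 038X: descent of regularity to the
perfect closure of `K` in `k`, regular ⇒ smooth over a perfect field, fpqc descent along the
purely inseparable closure). [cite: StacksProject, Tag 038X with Tag 02VL] -/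
theorem isSmoothAt_of_isSmoothAt_baseChange_field (Q : Ideal (L ⊗[K] A)) [Q.IsPrime]
    [Algebra.IsSmoothAt L Q] :
    Algebra.IsSmoothAt K (Q.comap (Algebra.TensorProduct.includeRight (R := K) (A := L) :
        A →ₐ[K] L ⊗[K] A).toRingHom) := by
  classical
  haveI : Algebra.FinitePresentation K A :=
    (Algebra.FinitePresentation.of_finiteType (R := K) (A := A)).mp inferInstance
  let k := AlgebraicClosure L
  -- a prime `Q₁` of `k ⊗_L (L ⊗_K A)` over `Q`
  obtain ⟨Q₁, hQ₁, hQ₁Q⟩ := exists_isPrime_over_of_baseChange_field (κ := L) (K := k) (F := L ⊗[K] A) Q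
  haveI := hQ₁
  -- smooth at `Q₁`, hence regular there
  haveI : Algebra.IsSmoothAt k Q₁ := isSmoothAt_baseChange k Q Q₁ hQ₁Q
  haveI : IsRegularLocalRing (Localization.AtPrime Q₁) :=
    isRegularLocalRing_of_isSmoothAt k (k ⊗[L] (L ⊗[K] A)) Q₁
  -- transport to `k ⊗_K A`
  let e : k ⊗[L] (L ⊗[K] A) ≃ₐ[k] k ⊗[K] A := Algebra.TensorProduct.cancelBaseChange K L k k A
  let Q₂ : Ideal (k ⊗[K] A) := Q₁.comap e.symm.toRingEquiv.toRingHom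
  haveI : Q₂.IsPrime := Ideal.comap_isPrime _ Q₁
  haveI : IsRegularLocalRing (Localization.AtPrime Q₂) :=
    isRegularLocalRing_localization_comap_ringEquiv e.symm.toRingEquiv Q₁
  -- the field case over the perfect field `k`
  have h := isSmoothAt_of_isRegularLocalRing_tensor_perfectField K A k Q₂
  have hQ : Q₂.comap (Algebra.TensorProduct.includeRight (R := K) (A := k) :
      A →ₐ[K] k ⊗[K] A).toRingHom =
      Q.comap (Algebra.TensorProduct.includeRight (R := K) (A := L) : A →ₐ[K] L ⊗[K] A).toRingHom := by
    ext a
    simp only [Ideal.mem_comap, AlgHom.toRingHom_eq_coe, RingHom.coe_coe,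
      Algebra.TensorProduct.includeRight_apply, Q₂]
    change e.symm ((1 : k) ⊗ₜ[K] a) ∈ Q₁ ↔ _
    rw [Algebra.TensorProduct.cancelBaseChange_symm_tmul, ← hQ₁Q, Ideal.mem_comap]
    rfl
  have key : ∀ (I J : Ideal A) [I.IsPrime] [J.IsPrime], I = J →
      Algebra.IsSmoothAt K I → Algebra.IsSmoothAt K J := by
    rintro I J _ _ rfl hI
    exact hI
  exact key _ _ hQ h

end FieldDescent


end Summit.ResolutionOfSingularities.ResolutionOfSingularities.Theorems.CampaignW82

end
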